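import Summits.AtomisticToContinuum.Crystallization.Theorems.ChartedZeroExcessLayeredLatticeLiouvilleTV

/-!
# Zero-excess layered lattice Liouville — part TZ (lens-2 g42 node «StrainSparseReformulation», helpers): window bookkeeping, radius shifts, bond distortion

First half (mechanical split at the 400-line ceiling) of the node «StrainSparseReformulation»; the Prop (M♭)_ϑ `StrainSparsePG` and its PROVED
dictionary with (M) `StrainNonConcentrationPG` and (R_W) `WildFractionPG` are part TZM, which imports this file.  Contents (all sorry-free, no Prop):
* XX.1 finite-sum bookkeeping on windows (`winsum_*`, `le_winsum_of_mem`, `nK_le_nK_of_subset`);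
* XX.2 the window density constant `winDensC δ = (10(2/δ+1))³` of part TV (K_dens) and the radius shifts `R ↔ R + 4` of a global registration on door
  sets: `IsGlobalReg.radius_add_four` (`(Cg, η, R) ↦ (2Cg, η, R+4)`, `R ≥ 4`) and `IsGlobalReg.radius_of_add_four` (`(Cg, η, R+4) ↦ (4c²Cg, η, R)`,
  `c = winDensC δ`, `R ≥ 12`, `aHi ≤ 8/7`);
* XX.3 tilt–strain bookkeeping: the identity rotation has determinant `1`, the tear-free `12`-bound on rotated bond defects, and `bondDistSup S Ψ x`,
  the largest distortion of a `4`-bond at `x` (attained on δ-separated sets);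
* XX.4 the census currency `strainMassAbove t K σ = Σ_{x ∈ K, σ x ≥ t} σ x²` ((F1) of MEMO-g43-M).
No mechanism is claimed here: glue for the line `_16XH19(_tol)`.
-/

noncomputable section

open scoped BigOperators
open MeasureTheory Set Metric Filter Topology
open Summit.AtomisticToContinuum.Crystallization.Theorems.ChartedPlanarOrderRigidityDoor (E3 atomsIn)
open Summit.AtomisticToContinuum.Crystallization.Theorems.ChartedPlanarOrderDensityDichotomy (μS IsSep nK nK_nonneg)
open Summit.AtomisticToContinuum.Crystallization.Theorems.ChartedPlanarOrderCleanScaleP (IsCleanP IsDoorSetP)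
open Summit.AtomisticToContinuum.Crystallization.Theorems.ChartedPlanarOrderMesoCut (LayeredHom EnvClose)
open Summit.AtomisticToContinuum.Crystallization.Theorems.ChartedPlanarOrderDoorLayered (atomsIn_subset)
open Summit.AtomisticToContinuum.Crystallization.Theorems.ChartedPlanarOrderDoorLayeredOsc (IsTwoShellAffineGood)

namespace Summit.AtomisticToContinuum.Crystallization.Theorems.ChartedZeroExcessLayeredLatticeLiouville

/-! ### XX.1  Finite-sum bookkeeping on windows -/

/-- monotonicity of a window sum under a pointwise bound. [folklore] -/
theorem winsum_le_winsum_of_le {K : Set E3} (hK : K.Finite) {f g : E3 → ℝ} (h : ∀ x ∈ K, f x ≤ g x) :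
    ∑ᶠ x ∈ K, f x ≤ ∑ᶠ x ∈ K, g x := by
  rw [finsum_mem_eq_finite_toFinset_sum _ hK, finsum_mem_eq_finite_toFinset_sum _ hK]
  exact Finset.sum_le_sum fun x hx => h x (hK.mem_toFinset.1 hx)

/-- a sum of nonnegative terms grows with the window. [folklore] -/
private theorem winsum_le_winsum_of_subset {K K' : Set E3} (hK' : K'.Finite) (hsub : K ⊆ K') {f : E3 → ℝ} (h : ∀ x ∈ K', 0 ≤ f x) :
    ∑ᶠ x ∈ K, f x ≤ ∑ᶠ x ∈ K', f x := by
  have hK : K.Finite := hK'.subset hsub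
  rw [finsum_mem_eq_finite_toFinset_sum _ hK, finsum_mem_eq_finite_toFinset_sum _ hK']
  refine Finset.sum_le_sum_of_subset_of_nonneg (fun x hx => hK'.mem_toFinset.2 (hsub (hK.mem_toFinset.1 hx))) fun x hx _ => h x (hK'.mem_toFinset.1 hx)

/-- linearity of a window sum. [folklore] -/
theorem winsum_add_mul_eq {K : Set E3} (hK : K.Finite) (a b : ℝ) (f g : E3 → ℝ) :
    ∑ᶠ x ∈ K, (a * f x + b * g x) = a * ∑ᶠ x ∈ K, f x + b * ∑ᶠ x ∈ K, g x := by
  rw [finsum_mem_eq_finite_toFinset_sum _ hK, finsum_mem_eq_finite_toFinset_sum _ hK, finsum_mem_eq_finite_toFinset_sum _ hK,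
    Finset.sum_add_distrib, Finset.mul_sum, Finset.mul_sum]

/-- constants come out of a window sum. [folklore] -/
theorem winsum_const_mul {K : Set E3} (hK : K.Finite) (a : ℝ) (f : E3 → ℝ) :
    ∑ᶠ x ∈ K, a * f x = a * ∑ᶠ x ∈ K, f x := by
  rw [finsum_mem_eq_finite_toFinset_sum _ hK, finsum_mem_eq_finite_toFinset_sum _ hK, Finset.mul_sum]

/-- a single nonnegative term is at most the window sum. [folklore] -/
theorem le_winsum_of_mem {K : Set E3} (hK : K.Finite) {f : E3 → ℝ} (h : ∀ x ∈ K, 0 ≤ f x) {a : E3} (ha : a ∈ K) :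
    f a ≤ ∑ᶠ x ∈ K, f x := by
  rw [finsum_mem_eq_finite_toFinset_sum _ hK]
  exact Finset.single_le_sum (fun x hx => h x (hK.mem_toFinset.1 hx)) (hK.mem_toFinset.2 ha)

/-- the site count grows with the window. [folklore] -/
theorem nK_le_nK_of_subset {K K' : Set E3} (hK' : K'.Finite) (h : K ⊆ K') : nK K ≤ nK K' := by
  unfold nK
  exact_mod_cast Set.ncard_le_ncard h hK'

/-! ### XX.2  The window density constant and the radius shifts `R ↔ R + 4` of a global registration -/

/-- the window density constant `c = (10(2/δ+1))³` of part TV (K_dens). [this file, g42] -/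
def winDensC (δ : ℝ) : ℝ := (10 * (2 / δ + 1)) ^ 3

/-- `1 ≤ c`. [this file, g42] -/
theorem one_le_winDensC {δ : ℝ} (hδ : 0 < δ) : 1 ≤ winDensC δ := by
  have h : 0 ≤ 2 / δ := div_nonneg (by norm_num) hδ.le
  have h1 : (1 : ℝ) ≤ 10 * (2 / δ + 1) := by linarith
  exact one_le_pow₀ h1

/-- density ratio `win (R+4)` versus `win R` on door sets (`R ≥ 12`): `nK(win (R+4)) ≤ c²·nK(win R)` (K_dens twice). [this file, g42] -/
theorem nK_atomsIn_add_four_le {aHi δ : ℝ} (haHi : aHi ≤ 8 / 7) (hδ : 0 < δ) {S : Set E3} (hS : IsDoorSetP aHi δ S) {R : ℝ} (hR : 12 ≤ R) :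
    nK (atomsIn (μS S) 0 (R + 4)) ≤ winDensC δ ^ 2 * nK (atomsIn (μS S) 0 R) := by
  have h1 := nK_atomsIn_le_mul_nK_atomsIn_sub_two haHi hδ hS (by linarith : (14 : ℝ) ≤ R + 4)
  have h2 := nK_atomsIn_le_mul_nK_atomsIn_sub_two haHi hδ hS (by linarith : (14 : ℝ) ≤ R + 2)
  rw [show R + 4 - 2 = R + 2 by ring] at h1
  rw [show R + 2 - 2 = R by ring] at h2
  have hc : 0 ≤ winDensC δ := zero_le_one.trans (one_le_winDensC hδ)
  calc nK (atomsIn (μS S) 0 (R + 4)) ≤ winDensC δ * nK (atomsIn (μS S) 0 (R + 2)) := h1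
    _ ≤ winDensC δ * (winDensC δ * nK (atomsIn (μS S) 0 R)) := mul_le_mul_of_nonneg_left h2 hc
    _ = winDensC δ ^ 2 * nK (atomsIn (μS S) 0 R) := by ring

/-- a `4`-neighbour of a site of `win R` lies in `win (R + 4)`. [this file, g42] -/
theorem mem_atomsIn_add_four {S : Set E3} {R : ℝ} {x p : E3} (hx : x ∈ atomsIn (μS S) 0 R) (hp : p ∈ S) (hpx : dist p x ≤ 4) :
    p ∈ atomsIn (μS S) 0 (R + 4) := by
  refine mem_atomsIn_iff.2 ⟨hp, ?_⟩
  have hx' := (mem_atomsIn_iff.1 hx).2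
  calc ‖p‖ = ‖p - x + x‖ := by rw [sub_add_cancel]
    _ ≤ ‖p - x‖ + ‖x‖ := norm_add_le _ _
    _ ≤ 4 + R := add_le_add (by rwa [← dist_eq_norm]) hx'
    _ = R + 4 := by ring

/-- RADIUS UP: a global registration at `(Cg, η, R)` is one at `(2Cg, η, R + 4)` (`R ≥ 4`: `D/R ≤ 2·D/(R+4)`). [this file, g42] -/
theorem IsGlobalReg.radius_add_four {Cg η R : ℝ} (hCg : 0 ≤ Cg) (hη : 0 ≤ η) (hR : 4 ≤ R) {S H : Set E3} {Ψ : E3 → E3}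
    (h : IsGlobalReg Cg η R S H Ψ) : IsGlobalReg (2 * Cg) η (R + 4) S H Ψ := by
  obtain ⟨hbij, ht1, ht2, hreg⟩ := h
  refine ⟨hbij, ht1, ht2, fun D hD => ?_⟩
  obtain ⟨τ, hτ⟩ := hreg D (by linarith)
  refine ⟨τ, hτ.mono (mul_le_mul_of_nonneg_right ?_ hη)⟩
  have hRpos : 0 < R := by linarith
  have hR4 : 0 < R + 4 := by linarith
  have hD0 : 0 ≤ D := by linarith
  have h1 : D / R ≤ 2 * (D / (R + 4)) := by
    rw [div_le_iff₀ hRpos, show 2 * (D / (R + 4)) * R = D * (2 * R) / (R + 4) by ring, le_div_iff₀ hR4]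
    nlinarith
  calc Cg * (D / R) ≤ Cg * (2 * (D / (R + 4))) := mul_le_mul_of_nonneg_left h1 hCg
    _ = 2 * Cg * (D / (R + 4)) := by ring

/-- RADIUS DOWN on door sets: a global registration at `(Cg, η, R + 4)` is one at `(4c²·Cg, η, R)` (`R ≥ 12`, `aHi ≤ 8/7`): at scales `D ≥ R + 4`
directly; at scales `R ≤ D < R + 4` by RESTRICTING the registration data of scale `R + 4` to `win D`, the window density ratio `c²` paying for the
normalisation by `nK(win D)` and `(R+4)² ≤ 4D²` for the position level. [this file, g42] -/
theorem IsGlobalReg.radius_of_add_four {aHi δ : ℝ} (haHi : aHi ≤ 8 / 7) (hδ : 0 < δ) {S : Set E3} (hS : IsDoorSetP aHi δ S)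
    {Cg η R : ℝ} (hCg : 0 ≤ Cg) (hη : 0 ≤ η) (hR : 12 ≤ R) {H : Set E3} {Ψ : E3 → E3}
    (h : IsGlobalReg Cg η (R + 4) S H Ψ) : IsGlobalReg (4 * winDensC δ ^ 2 * Cg) η R S H Ψ := by
  obtain ⟨hbij, ht1, ht2, hreg⟩ := h
  refine ⟨hbij, ht1, ht2, fun D hD => ?_⟩
  have hc1 : 1 ≤ winDensC δ := one_le_winDensC hδ
  have hc2 : 1 ≤ winDensC δ ^ 2 := one_le_pow₀ hc1
  have hRpos : 0 < R := by linarith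
  have hDpos : 0 < D := by linarith
  have hDR : 1 ≤ D / R := by rw [le_div_iff₀ hRpos]; linarith
  by_cases hD4 : R + 4 ≤ D
  · obtain ⟨τ, hτ⟩ := hreg D hD4
    refine ⟨τ, hτ.mono (mul_le_mul_of_nonneg_right ?_ hη)⟩
    have h1 : D / (R + 4) ≤ D / R := div_le_div_of_nonneg_left hDpos.le hRpos (by linarith)
    have h0 : 0 ≤ Cg * (D / R) := by positivity
    calc Cg * (D / (R + 4)) ≤ Cg * (D / R) := mul_le_mul_of_nonneg_left h1 hCg
      _ = 1 * (Cg * (D / R)) := by ring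
      _ ≤ 4 * winDensC δ ^ 2 * (Cg * (D / R)) := mul_le_mul_of_nonneg_right (by nlinarith) h0
      _ = 4 * winDensC δ ^ 2 * Cg * (D / R) := by ring
  · push Not at hD4
    obtain ⟨τ, hinj, hmaps, henv, hdom, hgrad, hpos⟩ := hreg (R + 4) le_rfl
    set WD := atomsIn (μS S) 0 D with hWD
    set W4 := atomsIn (μS S) 0 (R + 4) with hW4
    set WR := atomsIn (μS S) 0 R with hWR
    have hsub : WD ⊆ W4 := atomsIn_mono_radius hD4.le
    have hfin4 : W4.Finite := finite_atomsIn hδ hS.2.1 _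
    have hfinD : WD.Finite := finite_atomsIn hδ hS.2.1 _
    have hdens : nK W4 ≤ winDensC δ ^ 2 * nK WR := nK_atomsIn_add_four_le haHi hδ hS hR
    have hmonoRD : nK WR ≤ nK WD := nK_le_nK_of_subset hfinD (atomsIn_mono_radius hD)
    have hdens' : nK W4 ≤ winDensC δ ^ 2 * nK WD := hdens.trans (mul_le_mul_of_nonneg_left hmonoRD (by positivity))
    have hκ : Cg * ((R + 4) / (R + 4)) * η = Cg * η := by rw [div_self (by linarith : (R + 4) ≠ 0), mul_one]
    rw [hκ] at hgrad hpos
    have hnD := nK_nonneg WD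
    have hbase : 0 ≤ winDensC δ ^ 2 * Cg * η * nK WD := by positivity
    refine ⟨τ, hinj.mono hsub, hmaps.mono_left hsub, fun x hx => henv x (hsub hx), fun x hx p hp hpx => hdom x (hsub hx) p (hsub hp) hpx, ?_, ?_⟩
    · calc ∑ᶠ x ∈ WD, τ x ^ 2 ≤ ∑ᶠ x ∈ W4, τ x ^ 2 := winsum_le_winsum_of_subset hfin4 hsub fun x _ => sq_nonneg _
        _ ≤ Cg * η * nK W4 := hgrad
        _ ≤ Cg * η * (winDensC δ ^ 2 * nK WD) := mul_le_mul_of_nonneg_left hdens' (by positivity)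
        _ = winDensC δ ^ 2 * Cg * η * nK WD * 1 := by ring
        _ ≤ winDensC δ ^ 2 * Cg * η * nK WD * (4 * (D / R)) := mul_le_mul_of_nonneg_left (by linarith) hbase
        _ = 4 * winDensC δ ^ 2 * Cg * (D / R) * η * nK WD := by ring
    · have hR4D : (R + 4) ^ 2 ≤ 4 * (D / R) * D ^ 2 := by
        have h1 : (R + 4) ^ 2 ≤ (2 * D) ^ 2 := pow_le_pow_left₀ (by linarith) (by linarith) 2
        have h2 : (2 * D) ^ 2 = 4 * 1 * D ^ 2 := by ring
        have h3 : 4 * 1 * D ^ 2 ≤ 4 * (D / R) * D ^ 2 := by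
          have : 0 ≤ D ^ 2 := sq_nonneg _
          nlinarith
        linarith
      calc ∑ᶠ x ∈ WD, ‖x - Ψ x‖ ^ 2 ≤ ∑ᶠ x ∈ W4, ‖x - Ψ x‖ ^ 2 := winsum_le_winsum_of_subset hfin4 hsub fun x _ => sq_nonneg _
        _ ≤ Cg * η * (R + 4) ^ 2 * nK W4 := hpos
        _ ≤ Cg * η * (R + 4) ^ 2 * (winDensC δ ^ 2 * nK WD) := mul_le_mul_of_nonneg_left hdens' (by positivity)
        _ = winDensC δ ^ 2 * Cg * η * nK WD * (R + 4) ^ 2 := by ring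
        _ ≤ winDensC δ ^ 2 * Cg * η * nK WD * (4 * (D / R) * D ^ 2) := mul_le_mul_of_nonneg_left hR4D hbase
        _ = 4 * winDensC δ ^ 2 * Cg * (D / R) * η * D ^ 2 * nK WD := by ring

/-! ### XX.3  Tilt–strain data: the identity rotation, the `12`-bound, the largest bond distortion -/

/-- the identity is a rotation of determinant `1`. [folklore] -/
theorem det_refl_E3_eq_one : LinearMap.det ((LinearIsometryEquiv.refl ℝ E3).toLinearEquiv : E3 →ₗ[ℝ] E3) = 1 := by
  have h : ((LinearIsometryEquiv.refl ℝ E3).toLinearEquiv : E3 →ₗ[ℝ] E3) = LinearMap.id := by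
    ext v
    simp
  rw [h, LinearMap.det_id]

/-- under a tear-free (`4 ↦ 8`) map every rotated `4`-bond misfit is `≤ 12`. [this file, g42] -/
theorem dist_rot_bond_le_twelve {S : Set E3} {Ψ : E3 → E3} (htear : ∀ x ∈ S, ∀ p ∈ S, dist p x ≤ 4 → dist (Ψ p) (Ψ x) ≤ 8)
    (U : E3 ≃ₗᵢ[ℝ] E3) {x p : E3} (hx : x ∈ S) (hp : p ∈ S) (hpx : dist p x ≤ 4) : dist (U (p - x)) (Ψ p - Ψ x) ≤ 12 := by
  rw [dist_eq_norm]
  calc ‖U (p - x) - (Ψ p - Ψ x)‖ ≤ ‖U (p - x)‖ + ‖Ψ p - Ψ x‖ := norm_sub_le _ _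
    _ = ‖p - x‖ + dist (Ψ p) (Ψ x) := by rw [LinearIsometryEquiv.norm_map, dist_eq_norm]
    _ ≤ 4 + 8 := add_le_add (by rwa [← dist_eq_norm]) (htear x hx p hp hpx)
    _ = 12 := by norm_num

/-- the LARGEST DISTORTION of a `4`-bond at `x` (against the identity), `bondDistSup S Ψ x := max 0 (sup_{p ∈ S, dist p x ≤ 4} ‖(p − x) − (Ψ p − Ψ x)‖)` —
a finite supremum on separated `S`, attained at some bond when positive. [this file, g42] -/
def bondDistSup (S : Set E3) (Ψ : E3 → E3) (x : E3) : ℝ := max 0 (sSup ((fun p => dist (p - x) (Ψ p - Ψ x)) '' (S ∩ closedBall x 4)))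

/-- the `4`-ball of a site meets a separated set in a finite set. [folklore] -/
theorem finite_inter_closedBall_four {δ : ℝ} (hδ : 0 < δ) {S : Set E3} (hsep : IsSep δ S) (x : E3) : (S ∩ closedBall x 4).Finite := by
  refine (finite_atomsIn hδ hsep (‖x‖ + 4)).subset fun p hp => mem_atomsIn_iff.2 ⟨hp.1, ?_⟩
  have hpx : dist p x ≤ 4 := mem_closedBall.1 hp.2
  calc ‖p‖ = ‖p - x + x‖ := by rw [sub_add_cancel]
    _ ≤ ‖p - x‖ + ‖x‖ := norm_add_le _ _
    _ ≤ 4 + ‖x‖ := add_le_add (by rwa [← dist_eq_norm]) le_rfl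
    _ = ‖x‖ + 4 := by ring

/-- `0 ≤ bondDistSup`. [this file, g42] -/
theorem bondDistSup_nonneg (S : Set E3) (Ψ : E3 → E3) (x : E3) : 0 ≤ bondDistSup S Ψ x := le_max_left _ _

/-- `bondDistSup` dominates every `4`-bond distortion at `x`. [this file, g42] -/
theorem dist_bond_le_bondDistSup {δ : ℝ} (hδ : 0 < δ) {S : Set E3} (hsep : IsSep δ S) (Ψ : E3 → E3) {x p : E3} (hp : p ∈ S) (hpx : dist p x ≤ 4) :
    dist (p - x) (Ψ p - Ψ x) ≤ bondDistSup S Ψ x := by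
  have hfin := (finite_inter_closedBall_four hδ hsep x).image (fun p => dist (p - x) (Ψ p - Ψ x))
  refine le_trans ?_ (le_max_right _ _)
  exact le_csSup hfin.bddAbove ⟨p, ⟨hp, mem_closedBall.2 hpx⟩, rfl⟩

/-- a POSITIVE `bondDistSup` at a site of `S` is attained: some `4`-bond at `x` has exactly that distortion. [this file, g42] -/
theorem exists_bond_eq_bondDistSup {δ : ℝ} (hδ : 0 < δ) {S : Set E3} (hsep : IsSep δ S) (Ψ : E3 → E3) {x : E3} (hx : x ∈ S)
    (hpos : 0 < bondDistSup S Ψ x) : ∃ p ∈ S, dist p x ≤ 4 ∧ dist (p - x) (Ψ p - Ψ x) = bondDistSup S Ψ x := by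
  set T := (fun p => dist (p - x) (Ψ p - Ψ x)) '' (S ∩ closedBall x 4) with hT
  have hfin : T.Finite := (finite_inter_closedBall_four hδ hsep x).image _
  have hne : T.Nonempty := ⟨_, ⟨x, ⟨hx, mem_closedBall_self (by norm_num)⟩, rfl⟩⟩
  have hmem := hne.csSup_mem hfin
  obtain ⟨p, ⟨hpS, hpB⟩, hpeq⟩ := hmem
  have hsup : bondDistSup S Ψ x = sSup T := by
    rcases le_total 0 (sSup T) with h0 | h0
    · exact max_eq_right h0
    · have : bondDistSup S Ψ x = 0 := max_eq_left h0
      exact absurd this hpos.ne'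
  exact ⟨p, hpS, mem_closedBall.1 hpB, by rw [hsup]; exact hpeq⟩

/-! ### XX.4  The census currency `strainMassAbove` -/

/-- the strain MASS ABOVE the threshold `t` of a profile `σ` on the chunk `K`: `Σ_{x ∈ K, σ x ≥ t} σ x²` (census currency (F1) of MEMO-g43-M). [this file, g42] -/
def strainMassAbove (t : ℝ) (K : Set E3) (σ : E3 → ℝ) : ℝ := ∑ᶠ x ∈ K, if t ≤ σ x then σ x ^ 2 else 0

end Summit.AtomisticToContinuum.Crystallization.Theorems.ChartedZeroExcessLayeredLatticeLiouville

end
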